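import Summits.AtomisticToContinuum.HydrodynamicLimit.Theorems.ImplosionDichotomyHydroLimitProfilewiseBandKcwfQGlue
import Summits.AtomisticToContinuum.HydrodynamicLimit.Theorems.OneFlightGossipEngineSuperExponentialEnergyTailsSplit
import Summits.AtomisticToContinuum.HydrodynamicLimit.Theorems.OneFlightGossipEngineLocalClampedTransferLDAlongFamiliesSAxisNet
import Summits.AtomisticToContinuum.HydrodynamicLimit.Theorems.OneFlightGossipEngineEnergyActivityTailsRecordGain
import Summits.AtomisticToContinuum.HydrodynamicLimit.Theorems.OneFlightGossipEngineEnergyActivityTailsCoboundary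
import Summits.AtomisticToContinuum.HydrodynamicLimit.Theorems.OneFlightGossipEngineEnergyActivityTailsPathwiseSplit
import Summits.AtomisticToContinuum.HydrodynamicLimit.Theorems.OneFlightGossipEngineEnergyActivityTailsHotSupplyMeasurable
import Summits.AtomisticToContinuum.HydrodynamicLimit.Theorems.OneFlightGossipEngineEnergyActivityTailsTailAssembly
import Summits.AtomisticToContinuum.HydrodynamicLimit.Theorems.OneFlightGossipEngineEnergyActivityTailsHotSupplyRungs
import HarnessLib

/-!
# Leaf-level glue — crux `HydroLimitProfilewiseBand` (stmt-AtomisticToContinuum-17372), line `IdeatorOneSketch` v17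

Route `ImplosionDichotomy`, sub-problem `HydrodynamicLimit`; lead prover-line-stmt-AtomisticToContinuum-17372-c12-0 (line cycle 13).

The registered skeleton of the line (`Cruxes/HydroLimitProfilewiseBand/Lines/IdeatorOneSketch.lean`) closes the crux modulo two
ITEM-level stubs, `stub_kcwuSharpPlus` (crux 16659's single registered stub) and `stub_items4` = SEET (stmt-17701) ∧ LCTF (stmt-17691) ∧
EAT (stmt-17703) ∧ CAT (stmt-13734).  Each of those items has meanwhile been reduced BY ITS OWN LINE to registered research residues over
LANDED theorems:

* SEET ⟸ `PovznerCeiling ∧ ChaosCeiling ∧ RateFloor` — `SuperExponentialEnergyTailsSplit.SuperExponentialEnergyTails_of_contactInputs`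
  (Gevrey-3/2 moment scheme, p150541 over p146991 / p147071 / p147511 / p149096);
* LCTF ⟸ `LCTSharp` — `LocalClampedTransferSketch.stub_sAxisNet` (the s-axis net, p147087 over eight prelims);
* EAT ⟸ `CAT ∧ HotSupplyTailsIn` — `EnergyActivityTailsOfLeaves.energyActivityTails_of_leaves` (this lead, p160556, over 17703's landed K1–K4
  and measurability; INLINED below as the same one-line term over the five landed files — their verbatim def copies are definitionally equal —
  so that this file does not wait for the farm build of that module);
* KCWF-Q (stmt-18052) ⟸ `KCWUSharpPlus` — `HydroLimitProfilewiseBandKcwfQGlue.routeKcwfQ_of_kcwuSharpPlus` (p152902 over p152422).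

This file composes them with the landed item-level glue `hydroLimitProfilewiseBand_of_itemInputs` / `hydroLimitInBand_of_itemInputs`
(p152902): **the crux (and its sibling stmt-9133) from the SEVEN current research leaves of the whole input cone** —
`KCWUSharpPlus, PovznerCeiling, ChaosCeiling, RateFloor, LCTSharp, HotSupplyTailsIn, CollisionActivityTails` — every one the registered
open stub of its owner's line (16659 / 17701 ×3 / 17691 / 17703 / the item 13734 itself), with nothing un-itemed and nothing un-lined in
between.  `items4_of_leafInputs` is the registered sub-goal serving `stub_items4`; the two `…_of_leafInputs` theorems are the `--glue-by`
declarations for a leaf-level split.  All proofs are one-line compositions of landed theorems. [folklore]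

`KCWUSharpPlus` has no named definition in the tree (it is crux 16659's registered stub text); it is written unfolded, verbatim.
-/

noncomputable section

open MeasureTheory Set Filter
open scoped ENNReal Topology

namespace Summit.AtomisticToContinuum.HydrodynamicLimit.Theorems.HydroLimitProfilewiseBandLeafGlue

open Literature.Analysis.FluidPDE (HardSphereFlow Config localMaxwellian canonicalDensity liouville)
open Literature.MathematicalPhysics.KineticTheory (T3 V3 hsDiameter localGibbsLaw localGibbsMeasure
  localGibbsProfile)
open Literature.Analysis.FluidPDE Literature.MathematicalPhysics.KineticTheory
open Summit.AtomisticToContinuum.HydrodynamicLimit.Theses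
open Summit.AtomisticToContinuum.HydrodynamicLimit.Theorems.SuperExponentialEnergyTailsLine (PovznerCeiling ChaosCeiling RateFloor)
open Summit.AtomisticToContinuum.HydrodynamicLimit.Theorems.SuperExponentialEnergyTailsSplit (SuperExponentialEnergyTails_of_contactInputs)
open Summit.AtomisticToContinuum.HydrodynamicLimit.Theorems.LocalClampedTransferSketch (LCTSharp stub_sAxisNet)
open Summit.AtomisticToContinuum.HydrodynamicLimit.Theorems.EnergyActivityTailsHotSupplyRungs (HotSupplyTailsIn)
open Summit.AtomisticToContinuum.HydrodynamicLimit.Theorems.HydroLimitProfilewiseBandKcwfQGlue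
  (hydroLimitProfilewiseBand_of_itemInputs hydroLimitInBand_of_itemInputs routeKcwfQ_of_kcwuSharpPlus)

/-- **`stub_items4` of the 17372 / 9133 lines from the six non-kinetic leaves** (registered sub-goal of stmt-17372):
`PovznerCeiling → ChaosCeiling → RateFloor → LCTSharp → HotSupplyTailsIn → CAT → SEET ∧ LCTF ∧ EAT ∧ CAT`, by the three landed
item reductions. [folklore] -/
theorem items4_of_leafInputs :
    Summit.AtomisticToContinuum.HydrodynamicLimit.Theorems.SuperExponentialEnergyTailsLine.PovznerCeiling →
      Summit.AtomisticToContinuum.HydrodynamicLimit.Theorems.SuperExponentialEnergyTailsLine.ChaosCeiling →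
      Summit.AtomisticToContinuum.HydrodynamicLimit.Theorems.SuperExponentialEnergyTailsLine.RateFloor →
      Summit.AtomisticToContinuum.HydrodynamicLimit.Theorems.LocalClampedTransferSketch.LCTSharp →
      Summit.AtomisticToContinuum.HydrodynamicLimit.Theorems.EnergyActivityTailsHotSupplyRungs.HotSupplyTailsIn →
      Summit.AtomisticToContinuum.HydrodynamicLimit.Theses.OneFlightGossipEngine.CollisionActivityTails →
      Summit.AtomisticToContinuum.HydrodynamicLimit.Theses.OneFlightGossipEngine.SuperExponentialEnergyTails ∧
        Summit.AtomisticToContinuum.HydrodynamicLimit.Theses.OneFlightGossipEngine.LocalClampedTransferLDAlongFamilies ∧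
        Summit.AtomisticToContinuum.HydrodynamicLimit.Theses.OneFlightGossipEngine.EnergyActivityTails ∧
        Summit.AtomisticToContinuum.HydrodynamicLimit.Theses.OneFlightGossipEngine.CollisionActivityTails :=
  fun hSD hCE hF hLs hH hC =>
    ⟨SuperExponentialEnergyTails_of_contactInputs hSD hCE hF, stub_sAxisNet hLs,
      -- = `EnergyActivityTailsOfLeaves.energyActivityTails_of_leaves hC hH` (p160556), inlined over the five landed 17703 files
      EnergyActivityTailsTailAssembly.stub_tailAssembly
        (EnergyActivityTailsPathwiseSplit.stub_pathwiseSplit EnergyActivityTailsRecordGain.stub_recordGain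
          EnergyActivityTailsCoboundary.stub_coboundary)
        EnergyActivityTailsHotSupplyMeasurable.stub_hotSupplyMeasurable hC hH,
      hC⟩

/-- **`HydroLimitProfilewiseBand` (stmt-17372) from the seven research leaves of its input cone** — `KCWUSharpPlus` (unfolded;
crux 16659's registered stub), `PovznerCeiling`, `ChaosCeiling`, `RateFloor` (17701's), `LCTSharp` (17691's), `HotSupplyTailsIn` (17703's),
`CollisionActivityTails` (the item 13734): the landed item-level glue (p152902) after the four landed item reductions. [folklore] -/
theorem hydroLimitProfilewiseBand_of_leafInputs
    (hK : ∃ η₀ : ℝ, 0 < η₀ ∧ ∀ (Θ U C Λ : ℝ), 1 ≤ Θ → 0 ≤ U → 0 ≤ C → 1 ≤ Λ → ∀ σ : ℝ, 0 < σ →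
        ∃ β₀ : ℝ, 0 < β₀ ∧
        ∀ (a θ₀ : T3 → ℝ) (u₀ : T3 → V3), Continuous a → Continuous θ₀ → Continuous u₀ →
        (∀ x, Λ⁻¹ ≤ a x ∧ a x ≤ Λ) → (∀ x, Θ⁻¹ ≤ θ₀ x ∧ θ₀ x ≤ Θ) → (∀ x, ‖u₀ x‖ ≤ U) →
        σ ^ 3 * (⨆ x, a x) ≤ η₀ * ∫ x, a x →
        ∀ Φ : (N : ℕ) →
          HardSphereFlow (Torus.geometry (Fin 3)) (hsDiameter σ N) (N + 1),
        ∀ (A : T3 → Fin 3 → Fin 3 → ℝ) (b : T3 → V3) (G K : T3 × ℝ → ℝ),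
        Continuous A → Continuous b → Continuous G → Continuous K →
        ∀ F : T3 × V3 → ℝ, (∀ y, F y =
          (∑ j : Fin 3, ∑ k : Fin 3, A y.1 j k * ((y.2 - u₀ y.1) j * (y.2 - u₀ y.1) k)) +
            (∑ j : Fin 3, b y.1 j * (y.2 - u₀ y.1) j) * G (y.1, ‖y.2 - u₀ y.1‖ ^ 2) +
            K (y.1, ‖y.2 - u₀ y.1‖ ^ 2)) →
        (∀ y, |F y| ≤ C * (1 + ‖y.2‖ ^ 2)) →
        (∀ x, ∫ v, F (x, v) * localMaxwellian 1 (θ₀ x) (u₀ x) v = 0) →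
        (∀ x (j : Fin 3), ∫ v, F (x, v) * v j * localMaxwellian 1 (θ₀ x) (u₀ x) v = 0) →
        (∀ x, ∫ v, F (x, v) * ‖v‖ ^ 2 * localMaxwellian 1 (θ₀ x) (u₀ x) v = 0) →
        ∀ β : ℝ, |β| ≤ β₀ → ∀ ε : ℝ, 0 < ε → ∃ τ₀ : ℝ, 0 < τ₀ ∧ ∀ τ : ℝ, τ₀ ≤ τ →
        ∃ N₀ : ℕ, ∀ N : ℕ, N₀ ≤ N →
          ∫⁻ z, ENNReal.ofReal (Real.exp (β * ∑ i : Fin (N + 1),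
              (τ * ((N : ℝ) + 1) ^ (-(1 / 3 : ℝ)))⁻¹ *
                ∫ r in (0 : ℝ)..(τ * ((N : ℝ) + 1) ^ (-(1 / 3 : ℝ))), F (((Φ N).flow r z) i)))
            ∂(localGibbsLaw σ a u₀ θ₀ N (Φ N)) ≤
          ENNReal.ofReal (Real.exp (ε * ((N : ℝ) + 1))))
    (hSD : PovznerCeiling) (hCE : ChaosCeiling) (hF : RateFloor) (hLs : LCTSharp) (hH : HotSupplyTailsIn)
    (hC : OneFlightGossipEngine.CollisionActivityTails) : ImplosionDichotomy.HydroLimitProfilewiseBand := by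
  obtain ⟨hS, hL, hE, -⟩ := items4_of_leafInputs hSD hCE hF hLs hH hC
  exact hydroLimitProfilewiseBand_of_itemInputs hS (routeKcwfQ_of_kcwuSharpPlus hK) hL hE hC

/-- **`HydroLimitInBand` (stmt-9133) from the same seven leaves** (the sibling crux; landed glue `hydroLimitInBand_of_itemInputs`).
[folklore] -/
theorem hydroLimitInBand_of_leafInputs
    (hK : ∃ η₀ : ℝ, 0 < η₀ ∧ ∀ (Θ U C Λ : ℝ), 1 ≤ Θ → 0 ≤ U → 0 ≤ C → 1 ≤ Λ → ∀ σ : ℝ, 0 < σ →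
        ∃ β₀ : ℝ, 0 < β₀ ∧
        ∀ (a θ₀ : T3 → ℝ) (u₀ : T3 → V3), Continuous a → Continuous θ₀ → Continuous u₀ →
        (∀ x, Λ⁻¹ ≤ a x ∧ a x ≤ Λ) → (∀ x, Θ⁻¹ ≤ θ₀ x ∧ θ₀ x ≤ Θ) → (∀ x, ‖u₀ x‖ ≤ U) →
        σ ^ 3 * (⨆ x, a x) ≤ η₀ * ∫ x, a x →
        ∀ Φ : (N : ℕ) →
          HardSphereFlow (Torus.geometry (Fin 3)) (hsDiameter σ N) (N + 1),
        ∀ (A : T3 → Fin 3 → Fin 3 → ℝ) (b : T3 → V3) (G K : T3 × ℝ → ℝ),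
        Continuous A → Continuous b → Continuous G → Continuous K →
        ∀ F : T3 × V3 → ℝ, (∀ y, F y =
          (∑ j : Fin 3, ∑ k : Fin 3, A y.1 j k * ((y.2 - u₀ y.1) j * (y.2 - u₀ y.1) k)) +
            (∑ j : Fin 3, b y.1 j * (y.2 - u₀ y.1) j) * G (y.1, ‖y.2 - u₀ y.1‖ ^ 2) +
            K (y.1, ‖y.2 - u₀ y.1‖ ^ 2)) →
        (∀ y, |F y| ≤ C * (1 + ‖y.2‖ ^ 2)) →
        (∀ x, ∫ v, F (x, v) * localMaxwellian 1 (θ₀ x) (u₀ x) v = 0) →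
        (∀ x (j : Fin 3), ∫ v, F (x, v) * v j * localMaxwellian 1 (θ₀ x) (u₀ x) v = 0) →
        (∀ x, ∫ v, F (x, v) * ‖v‖ ^ 2 * localMaxwellian 1 (θ₀ x) (u₀ x) v = 0) →
        ∀ β : ℝ, |β| ≤ β₀ → ∀ ε : ℝ, 0 < ε → ∃ τ₀ : ℝ, 0 < τ₀ ∧ ∀ τ : ℝ, τ₀ ≤ τ →
        ∃ N₀ : ℕ, ∀ N : ℕ, N₀ ≤ N →
          ∫⁻ z, ENNReal.ofReal (Real.exp (β * ∑ i : Fin (N + 1),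
              (τ * ((N : ℝ) + 1) ^ (-(1 / 3 : ℝ)))⁻¹ *
                ∫ r in (0 : ℝ)..(τ * ((N : ℝ) + 1) ^ (-(1 / 3 : ℝ))), F (((Φ N).flow r z) i)))
            ∂(localGibbsLaw σ a u₀ θ₀ N (Φ N)) ≤
          ENNReal.ofReal (Real.exp (ε * ((N : ℝ) + 1))))
    (hSD : PovznerCeiling) (hCE : ChaosCeiling) (hF : RateFloor) (hLs : LCTSharp) (hH : HotSupplyTailsIn)
    (hC : OneFlightGossipEngine.CollisionActivityTails) : ImplosionDichotomy.HydroLimitInBand := by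
  obtain ⟨hS, hL, hE, -⟩ := items4_of_leafInputs hSD hCE hF hLs hH hC
  exact hydroLimitInBand_of_itemInputs hS (routeKcwfQ_of_kcwuSharpPlus hK) hL hE hC

end Summit.AtomisticToContinuum.HydrodynamicLimit.Theorems.HydroLimitProfilewiseBandLeafGlue

end
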